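import Summits.Ventures.HodgeRepro2.T5HeckeTranspose
import Summits.Ventures.HodgeRepro2.T5HeckeMatrixCoefficient
import Summits.Ventures.HodgeRepro2.T5HeckeDualMatrixCoefficient

/-!
# The transpose is the adjoint of the Hecke action: `⟨T • l, v⟩ = ⟨l, T^∨ • v⟩`

For a smooth representation `π` on `V`, its smooth dual `π̃` (`T5SmoothDualRep`), `K`-fixed
vectors `v ∈ π^K`, `l ∈ (π̃)^K` and `T ∈ H(G, K)`, the printed identity
`⟨π̃(f) l, v⟩ = ⟨l, π(f^∨) v⟩` (adjointness of the Hecke action under `f ↦ f^∨`, `f^∨(g) = f(g⁻¹)`)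
takes the Haar-free form

  `⟨T • l, v⟩ = ⟨l, transposeOp T • v⟩`

(`apply_heckeSMul_eq_apply_heckeSMul_transposeOp`), PROVIDED the counting form of unimodularity
`#(Kg⁻¹K/K) = #(KgK/K)` holds (`hU`; supplied for an inversion-invariant Haar measure by
`T5HaarDoubleCosetInverse.ncard_orbit_inv_eq`).  Proof: both sides are `k`-linear in `T`
(`pairLeft`, `pairRight`), and on the double-coset basis `T_g` of `T5HeckeDoubleCosetBasis`
they read `#(KgK/K) · ⟨l, π(g⁻¹) v⟩` (`T5HeckeDualMatrixCoefficient`) and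
`#(Kg⁻¹K/K) · ⟨l, π(g⁻¹) v⟩` (`T5HeckeMatrixCoefficient` applied to `T_g^∨ = T_{g⁻¹}`,
`T5HeckeTranspose.transposeOp_doubleCosetOp`).
-/

namespace Summit.Ventures.HodgeRepro2.T5HeckeAdjoint

open T5HeckePermutationModule T5HeckeDoubleCoset T5HeckeDoubleCosetBasis T5HeckeConvolution
  T5HeckeTranspose T5SmoothDualRep T5HeckeMatrixCoefficient T5HeckeDualMatrixCoefficient
  LevelPositivity

section Basis

variable {G : Type*} [Group G] {k : Type*} [Field k] {K : Subgroup G}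

/-- The orbit of a representative of a finite double coset is that double coset. -/
theorem orbit_out_out_eq (ω : FiniteDoubleCoset K) :
    MulAction.orbit K ((Quotient.out (Quotient.out ω.1) : G) : G ⧸ K) = ω.1.orbit := by
  rw [QuotientGroup.out_eq', ← MulAction.orbitRel.Quotient.orbit_mk, Quotient.out_eq']

/-- The double coset of a representative of a finite double coset is finite. -/
theorem finite_orbit_out_out (ω : FiniteDoubleCoset K) :
    Finite (MulAction.orbit K ((Quotient.out (Quotient.out ω.1) : G) : G ⧸ K)) := by
  rw [orbit_out_out_eq]
  exact ω.2.to_subtype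

/-- The basis element of `T5HeckeDoubleCosetBasis` attached to a finite double coset is the
double-coset operator `T_g` of a representative `g`. -/
theorem heckeAlgebraBasis_eq_doubleCosetOp (ω : FiniteDoubleCoset K) :
    heckeAlgebraBasis k K ω =
      @doubleCosetOp G _ k _ K (Quotient.out (Quotient.out ω.1)) (finite_orbit_out_out ω) := by
  apply ext_of_apply_single_one
  rw [heckeAlgebraBasis_apply_single_one, doubleCosetOp_apply_single_one, doubleCosetVector,
    orbit_out_out_eq]

end Basis

section Adjoint

variable {G : Type*} [Group G] [TopologicalSpace G] [IsTopologicalGroup G] {k : Type*} [Field k]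
  {V : Type*} [AddCommGroup V] [Module k V] (ρ : Representation k G V) {K : Subgroup G}

/-- The functional underlying a `K`-fixed vector of the smooth dual is `K`-fixed in the
algebraic dual (`T5SmoothDual.smoothDualInvariants = (V^*)^K ⊓ (V^*)^∞`). -/
theorem val_mem_invariants_dual (l : invariants (smoothDualRep ρ) K) :
    (((l : SmoothDualSpace ρ).val : T5SmoothDual.smoothVectors ρ.dual) : Module.Dual k V) ∈
      invariants ρ.dual K := by
  have h := (invariantsEquivSmoothDualInvariants ρ l).2
  rw [invariantsEquivSmoothDualInvariants_apply, T5SmoothDual.smoothDualInvariants,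
    Submodule.mem_inf] at h
  exact h.1

/-- `T ↦ ⟨T • l, v⟩` is `k`-linear on `H(G, K)`. -/
noncomputable def pairLeft (l : invariants (smoothDualRep ρ) K) (v : V) :
    heckeAlgebra k K →ₗ[k] k where
  toFun T :=
    (((heckeSMul (smoothDualRep ρ) T l : invariants (smoothDualRep ρ) K) :
      SmoothDualSpace ρ).val : Module.Dual k V) v
  map_add' T T' := by
    rw [heckeSMul_add_left, Submodule.coe_add, SmoothDualSpace.val_add, Submodule.coe_add,
      LinearMap.add_apply]
  map_smul' c T := by
    rw [heckeSMul_smul_left, Submodule.coe_smul, SmoothDualSpace.val_smul, Submodule.coe_smul,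
      LinearMap.smul_apply, RingHom.id_apply]

/-- `T ↦ ⟨l, transposeOp T • v⟩` is `k`-linear on `H(G, K)`. -/
noncomputable def pairRight (hK : ∀ g : G, Finite (MulAction.orbit K (g : G ⧸ K)))
    (l : SmoothDualSpace ρ) (v : invariants ρ K) : heckeAlgebra k K →ₗ[k] k where
  toFun T := ((l.val : T5SmoothDual.smoothVectors ρ.dual) : Module.Dual k V)
    (heckeSMul ρ (transposeOp hK T) v)
  map_add' T T' := by
    rw [transposeOp_add, heckeSMul_add_left, Submodule.coe_add, map_add]
  map_smul' c T := by
    rw [transposeOp_smul, heckeSMul_smul_left, Submodule.coe_smul, map_smul, RingHom.id_apply]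

/-- THE ADJOINT IDENTITY ON A DOUBLE COSET: `⟨T_g • l, v⟩ = ⟨l, T_{g⁻¹} • v⟩` when
`#(Kg⁻¹K/K) = #(KgK/K)`. -/
theorem apply_heckeSMul_doubleCosetOp_eq (hK : ∀ g : G, Finite (MulAction.orbit K (g : G ⧸ K)))
    (g : G) [Finite (MulAction.orbit K (g : G ⧸ K))]
    (hU : (MulAction.orbit K ((g⁻¹ : G) : G ⧸ K)).ncard = (MulAction.orbit K (g : G ⧸ K)).ncard)
    (l : invariants (smoothDualRep ρ) K) (v : invariants ρ K) :
    pairLeft ρ l v (doubleCosetOp k K g) =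
      pairRight ρ hK (l : SmoothDualSpace ρ) v (doubleCosetOp k K g) := by
  haveI := hK g⁻¹
  show (((heckeSMul (smoothDualRep ρ) (doubleCosetOp k K g) l : invariants (smoothDualRep ρ) K) :
      SmoothDualSpace ρ).val : Module.Dual k V) v =
    (((l : SmoothDualSpace ρ).val : T5SmoothDual.smoothVectors ρ.dual) : Module.Dual k V)
      (heckeSMul ρ (transposeOp hK (doubleCosetOp k K g)) v)
  rw [heckeSMul_doubleCosetOp_smoothDualRep_apply ρ g l v.2, transposeOp_doubleCosetOp,
    apply_heckeSMul_doubleCosetOp ρ (val_mem_invariants_dual ρ l) g⁻¹ v, hU]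

/-- THE TRANSPOSE IS THE ADJOINT OF THE HECKE ACTION: for `l ∈ (π̃)^K`, `v ∈ π^K` and every
`T ∈ H(G, K)`, `⟨T • l, v⟩ = ⟨l, transposeOp T • v⟩`, provided `#(Kg⁻¹K/K) = #(KgK/K)` for all
`g` (the counting form of unimodularity). -/
theorem apply_heckeSMul_eq_apply_heckeSMul_transposeOp
    (hK : ∀ g : G, Finite (MulAction.orbit K (g : G ⧸ K)))
    (hU : ∀ g : G, (MulAction.orbit K ((g⁻¹ : G) : G ⧸ K)).ncard =
      (MulAction.orbit K (g : G ⧸ K)).ncard)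
    (T : heckeAlgebra k K) (l : invariants (smoothDualRep ρ) K) (v : invariants ρ K) :
    (((heckeSMul (smoothDualRep ρ) T l : invariants (smoothDualRep ρ) K) :
        SmoothDualSpace ρ).val : Module.Dual k V) v =
      (((l : SmoothDualSpace ρ).val : T5SmoothDual.smoothVectors ρ.dual) : Module.Dual k V)
        (heckeSMul ρ (transposeOp hK T) v) := by
  have h : pairLeft ρ l v = pairRight ρ hK (l : SmoothDualSpace ρ) v := by
    apply Module.Basis.ext (heckeAlgebraBasis k K)
    intro ω
    rw [heckeAlgebraBasis_eq_doubleCosetOp]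
    haveI := finite_orbit_out_out ω
    exact apply_heckeSMul_doubleCosetOp_eq ρ hK _ (hU _) l v
  exact LinearMap.congr_fun h T

end Adjoint

end Summit.Ventures.HodgeRepro2.T5HeckeAdjoint
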